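import Literature.MathematicalPhysics.QuantumLattice.GibbsLinearResponse
import Mathlib.Analysis.SpecialFunctions.Exponential

/-!
# Stub `stub_gibbsDerivCovariance` of line `registered` (`Lines/birth.lean`)
# (crux `LogColdToGround`, item stmt-HubbardSuperconductivity-8808, route LogColdTorus)

Finite-dimensional thermodynamics: for a Hermitian matrix `H` on a finite index type and any
matrix `O`, the Gibbs expectation `β ↦ ω_β(O) = tr(e^{-βH} O) / tr e^{-βH}`
(`Matrix.gibbsState β H O = (partitionFn β H)⁻¹ * (gibbsWeight β H * O).trace`,
`gibbsWeight β H = exp (-(β : ℂ) • H)`) is differentiable at every real `β` with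

  `d/dβ ω_β(O) = -(ω_β(H O) - ω_β(H) ω_β(O)) = -Cov_β(H, O)`.

Proof (the pattern of `GibbsLinearResponse.lean`, in the COMPLEX inverse temperature first):
`d/du e^{u(-H)} = e^{u(-H)} (-H)` (Mathlib's `hasDerivAt_exp_smul_const` in the `L2Operator`
normed algebra `Matrix m m ℂ`), composed with the continuous linear functional `X ↦ tr (X O)`
gives `d/du tr(e^{-uH} O) = -tr(e^{-uH} H O)` and (with `O = 1`) `d/du tr e^{-uH} = -tr(e^{-uH} H)`;
the quotient rule (`HasDerivAt.fun_div`, valid since `Z_β(H) = Σ e^{-βλᵢ} ≠ 0` for Hermitian `H`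
on a nonempty index type) and `field_simp; ring` give the covariance, and `HasDerivAt.comp_ofReal`
restricts to real `β`.  On the EMPTY index type every matrix is `0`, the Gibbs state is the junk
constant `0` and the claimed derivative is `-(0 - _ * 0) = 0` (`hasDerivAt_const`).

Sources: O. Bratteli, D. W. Robinson, *Operator Algebras and Quantum Statistical Mechanics II*,
§5.3.1; H. Tasaki, *Physics and Mathematics of Quantum Many-Body Systems* (2020), App. A.
Folklore; no definition is introduced.
-/

noncomputable section

namespace Summit.HubbardSuperconductivity.LogColdToGround.Thermo

open scoped Matrix.Norms.L2Operator
open Matrix NormedSpace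

section GibbsDeriv

variable {m : Type*} [Fintype m] [DecidableEq m]

/-- The Gibbs weight as the exponential of a complex multiple of `-H`:
`e^{-βH} = exp ((β : ℂ) • (-H))`. [folklore] -/
theorem gibbsWeight_eq_exp_coe_smul_neg (b : ℝ) (H : Matrix m m ℂ) :
    gibbsWeight b H = exp ((b : ℂ) • (-H)) := by
  rw [gibbsWeight, smul_neg, neg_smul]

/-- **`d/du tr(e^{-uH} O) = -tr(e^{-uH} (H O))`** in the complex inverse temperature `u`
(`d/du e^{u(-H)} = e^{u(-H)} (-H)` composed with the linear functional `X ↦ tr (X O)`).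
Bratteli–Robinson II §5.3.1. [folklore] -/
theorem hasDerivAt_trace_exp_smul_neg_mul (H O : Matrix m m ℂ) (z : ℂ) :
    HasDerivAt (fun u : ℂ => (exp (u • (-H)) * O).trace) (-(exp (z • (-H)) * (H * O)).trace) z := by
  set L : Matrix m m ℂ →L[ℂ] ℂ :=
    LinearMap.toContinuousLinearMap ((Matrix.traceLinearMap m ℂ ℂ) ∘ₗ (LinearMap.mulRight ℂ O))
    with hL
  have hLapply : ∀ X : Matrix m m ℂ, L X = (X * O).trace := fun X => rfl
  have h := L.hasFDerivAt.comp_hasDerivAt z (hasDerivAt_exp_smul_const (-H) z)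
  have hfun : (fun u : ℂ => (exp (u • (-H)) * O).trace) =
      (L : Matrix m m ℂ → ℂ) ∘ fun u : ℂ => exp (u • (-H)) := by
    funext u
    simp only [Function.comp_apply, hLapply]
  rw [hfun]
  refine h.congr_deriv ?_
  rw [hLapply, Matrix.mul_neg, Matrix.neg_mul, trace_neg, Matrix.mul_assoc]

/-- **`d/du tr e^{-uH} = -tr(e^{-uH} H)`** in the complex inverse temperature `u`.
Bratteli–Robinson II §5.3.1. [folklore] -/
theorem hasDerivAt_trace_exp_smul_neg (H : Matrix m m ℂ) (z : ℂ) :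
    HasDerivAt (fun u : ℂ => (exp (u • (-H))).trace) (-(exp (z • (-H)) * H).trace) z := by
  have h := hasDerivAt_trace_exp_smul_neg_mul H 1 z
  simp only [Matrix.mul_one] at h
  exact h

/-- **The Gibbs expectation in a complex inverse temperature has derivative minus the
energy–observable covariance**: with `W = e^{-zH}` and `tr W ≠ 0`,
`d/dz [tr(W O)/tr W] = -(tr(W H O)/tr W - (tr(W H)/tr W)(tr(W O)/tr W))` (quotient rule).
Bratteli–Robinson II §5.3.1; Tasaki (2020) App. A. [folklore] -/
theorem hasDerivAt_gibbsQuotient_complex (H O : Matrix m m ℂ) (z : ℂ)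
    (hZ : (exp (z • (-H))).trace ≠ 0) :
    HasDerivAt (fun u : ℂ => ((exp (u • (-H))).trace)⁻¹ * (exp (u • (-H)) * O).trace)
      (-(((exp (z • (-H))).trace)⁻¹ * (exp (z • (-H)) * (H * O)).trace -
        ((exp (z • (-H))).trace)⁻¹ * (exp (z • (-H)) * H).trace *
          (((exp (z • (-H))).trace)⁻¹ * (exp (z • (-H)) * O).trace))) z := by
  have hN := hasDerivAt_trace_exp_smul_neg_mul H O z
  have hD := hasDerivAt_trace_exp_smul_neg H z
  have hq := hN.fun_div hD hZ
  have hfun : (fun u : ℂ => ((exp (u • (-H))).trace)⁻¹ * (exp (u • (-H)) * O).trace) =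
      fun u : ℂ => (exp (u • (-H)) * O).trace / (exp (u • (-H))).trace := by
    funext u
    rw [div_eq_inv_mul]
  rw [hfun]
  refine hq.congr_deriv ?_
  set W : Matrix m m ℂ := exp (z • (-H))
  field_simp
  ring

/-- **`d/dβ ω_β(O) = -(ω_β(H O) - ω_β(H) ω_β(O))`** for the Gibbs state of a Hermitian matrix `H`
along REAL inverse temperatures (ordinary instance binders; the registered stub below restates it
with unification-implicit instance binders). The empty index type is the junk case `0 = 0`.
Bratteli–Robinson II §5.3.1; Tasaki (2020) App. A. [folklore] -/
theorem hasDerivAt_gibbsState_inverseTemp (H O : Matrix m m ℂ) (hH : H.IsHermitian) (β : ℝ) :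
    HasDerivAt (fun b : ℝ => gibbsState b H O)
      (-(gibbsState β H (H * O) - gibbsState β H H * gibbsState β H O)) β := by
  rcases isEmpty_or_nonempty m with hm | hm
  · -- empty index type: every matrix is `0`, the Gibbs state is the constant `0`
    have hO : O = 0 := Subsingleton.elim _ _
    subst hO
    simp only [map_zero, mul_zero, sub_zero, neg_zero]
    exact hasDerivAt_const β 0
  · -- nonempty index type: `Z_β(H) = Σ e^{-βλᵢ} > 0`
    have hZ : partitionFn β H ≠ 0 := by
      rw [hH.partitionFn_eq_ofReal]
      exact_mod_cast (hH.sum_exp_pos β).ne'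
    have hZ' : (exp ((β : ℂ) • (-H))).trace ≠ 0 := by
      rwa [partitionFn, gibbsWeight_eq_exp_coe_smul_neg] at hZ
    have h := (hasDerivAt_gibbsQuotient_complex H O (β : ℂ) hZ').comp_ofReal
    have hfun : (fun b : ℝ => gibbsState b H O) =
        fun b : ℝ => ((exp ((b : ℂ) • (-H))).trace)⁻¹ * (exp ((b : ℂ) • (-H)) * O).trace := by
      funext b
      rw [gibbsState_apply, partitionFn, gibbsWeight_eq_exp_coe_smul_neg]
    rw [hfun]
    refine h.congr_deriv ?_
    simp only [gibbsState_apply, partitionFn, gibbsWeight_eq_exp_coe_smul_neg]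

end GibbsDeriv

/-- **Registered stub A — `GibbsDerivCovariance`** (finite-dimensional thermodynamics).  For a
Hermitian matrix `H` on a finite index type and any matrix `O`, the Gibbs expectation
`β ↦ ω_β(O)` (`Matrix.gibbsState β H O = (tr e^{-βH})⁻¹ tr(e^{-βH} O)`) has, at every `β ∈ ℝ`,
the derivative `-(ω_β(H·O) - ω_β(H)·ω_β(O))` (minus the energy–observable covariance).  The
instance binders are unification-implicit so that the statement applies verbatim to the crux's
sector-compressed matrices.  Proof: `hasDerivAt_gibbsState_inverseTemp`.
Bratteli–Robinson II §5.3.1; Tasaki (2020) App. A. [folklore] -/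
theorem stub_gibbsDerivCovariance : ∀ {m : Type} {_ : Fintype m} {_ : DecidableEq m} (H O : Matrix m m ℂ), H.IsHermitian →
    ∀ β : ℝ, HasDerivAt (fun b : ℝ => Matrix.gibbsState b H O)
      (-(Matrix.gibbsState β H (H * O) - Matrix.gibbsState β H H * Matrix.gibbsState β H O)) β :=
  fun H O hH β => hasDerivAt_gibbsState_inverseTemp H O hH β

end Summit.HubbardSuperconductivity.LogColdToGround.Thermo

end
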